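import Literature.AnabelianGeometry.EtaleTheta.Discharge.Sec5Thm57TorsionRootOfEtaleRigidity

/-!
# [EtTh] §5, Theorem 5.7 (C)-chain: the Cor. 2.8 (i) clause `hC5` HOLDS at `κ := κ_w` (the Kummer cocycle of the discrepancy unit),
# so the étale content of (C) is (tor) only (pp. 324–331 / PDF pp. 98–105)

Mochizuki, *The étale theta function and its Frobenioid-theoretic manifestations*, Publ. RIMS **45** (2009)
[cite: MochizukiEtTh2009, Thm 5.7 proof p.330 (PDF p.104); Thm 5.6 p.328 (PDF p.102); Prop 5.2 (iii) p.324 (PDF p.98); Cor 2.8 (i)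
p.268 (PDF p.42); Lem 5.8 p.331 (PDF p.105); Prop 4.3 (iii) p.317 (PDF p.91)].  abc-iut cell, layer L2, node `EtTh:Thm5.7`; seat
abc-iut-w5-d123 (gen 7), row «HC-TAUTOLOGY@κ_w» (abc-iut-L2-lead (gen 5) R705 = abc-iut-L2-d3 g7's named sequel (i), junction note
J-L2d3-1 (1), STATUS 2026-08-26T20:56:50Z).  PROOF-ONLY (0 definitions, 0 new named facts; nothing landed is edited or restated) over
abc-iut-L2-d4's `Sec5Thm57TorsionRootOfEtaleRigidity.lean` (p458762), `Sec5Thm57HCOfEtaleRigidity.lean` (p453757),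
`Sec5Thm57RigidOfKummerComparison.lean` (p448195), `Sec5Thm57Kummer.lean` (`psiAut_biKummerDiff`), and abc-iut-L2-t4's pin
`sgpCap_mul_sgpCup_inv_eq_of_thetaSectionCompat` — all consumed BY NAME.

THE POINT.  In the (C)-chain of Thm. 5.7 the per-level clause of `hrigid` is obtained (p458762
`exists_torsionRoot_isFixed_of_thetaSectionCompat`) from the Kummer comparison `HC` at a unit `ξ`, itself assembled (p453757) from
(pin) Prop. 5.2 (iii), (K4m) Thm. 5.6, (shadow), and the two R-C5 binders
  `hC5 : γ_Δ(η k) = η(γ k) · κ(γ k)`  (Cor. 2.8 (i) on the étale side)  and  `hκ : m⁻¹(κ(ι k)) = s^⊔-gp_N(ρ k)·ξ·s^⊔-gp_N(ρ k)⁻¹·ξ⁻¹`.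
abc-iut-L2-d3's junction note J-L2d3-1 (1) observed that `hC5` ALREADY holds with `κ := κ_w`, the (`m`-image of the) Kummer cocycle
`h ↦ s^⊔-gp_N(h)·w·s^⊔-gp_N(h)⁻¹·w⁻¹` of the DISCREPANCY unit `w` of the normalised transport `(a, b, e, w)` (`hT : a⁻¹Ψ(s^⊓)b = e ≫ s^⊓`,
`hT′ : a⁻¹Ψ(s^⊔)b = e ≫ s^⊔ ≫ w`).  THIS FILE proves it in p458762's binder shape:
* §1 `kummerComparison_at_discrepancy` — `HC` at `ξ := w` is the transport identity `psiAut_biKummerDiff` (abc-iut-L2-d4, T3) with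
  `D_c := 1`, `D_p := w`: a TAUTOLOGY of the normalised transport (no pin, no Thm. 5.6, no Cor. 2.8 (i)); `kummerComparison_of_kummerCocycle_eq`
  — hence `HC` at ANY `ξ` with the same `H_{B_N}`-Kummer cocycle as `w` (the only way `ξ` enters `HC`);
* §2 `hC5_of_kummerCocycle_discrepancy` — for ANY `κ : Π^tp_Ÿ → μ_N` realising `κ_w` (`hκw`, i.e. p458762's `hκ` AT `ξ := w`), the clause
  `hC5` holds for EVERY `k ∈ Π^tp_Ÿ`, from (pin) + (K4m) + (shadow) + §1 (a four-step rewrite pushed through `m⁻¹`, `m` injective);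
* §3 `kummerCocycle_discrepancy_mem_muTorsion` / `exists_kappa_discrepancy_hC5` — the values `κ_w(h)`, `h ∈ H_{B_N}`, lie in `μ_N(B_N)`
  (by §1, (pin), (K4m), (shadow) they are quotients of two `m⁻¹`-images), so such a `κ` EXISTS: `∃ κ, hκ@(ξ := w) ∧ hC5` —
  abc-iut-L2-d3's 'exists_hC5_of_kummerComparison';
* §4 `exists_torsionRoot_isFixed_of_kummerCocycle_eq` — CONSEQUENTLY the per-level clause of `hrigid` (`∃ ξ ∈ O^×(B_N), ξ^N = z ∧ w·ξ⁻¹`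
  `Π_Y`-fixed, VERBATIM p458762's conclusion) follows from the normalised transport data ALONE plus ONE statement about the discrepancy:
  (tor) «some unit `u·ζroot` (`u ∈ μ_N(B_N)`, `ζroot ∈ O^×(B_N)`, `ζroot^N = z`) has the SAME `H_{B_N}`-Kummer cocycle
  `h ↦ s^⊔-gp_N(h)·ξ·s^⊔-gp_N(h)⁻¹·ξ⁻¹` as `w`» — no (pin)/(K4m)/(C5ét) is consumed at this step at all.
So R-C5's residual content for the (C)-chain is VISIBLY (tor) = abc-iut-L2-d3's (II′) «`N`-th roots in `O^×(B_N)` of constants of `K` are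
`Δ`-fixed and their Kummer cocycle along `H_{B_N}` is `χ_c ∘ aug`» (Lemma 5.8 class, p.331 «`(O_K^×)^{1/N} := (K^×)^{1/N} ∩ O^×(B_N)`»),
together with whatever identifies the discrepancy's cocycle with such a `χ_c` ((SEP)/(T3) = GAP G-L2d3-8, Cor. 2.8 (i) F-0640 at the
(C)-chain's orbit datum) — the EtTh:Thm5.7 (C) RESIDUAL LIST v1 of record (abc-iut-L2-lead R664), unchanged and now kernel-visible.
HONEST FRAMING: kernel-checked identities between typed §5 data under the named transport hypotheses; (pin)/(K4m)/(shadow) and the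
normalised-transport clauses stay hypotheses BY NAME; (tor) is NOT proved here; nothing of [EtTh] (refereed) is asserted
unconditionally; typed ≠ discharged; no side taken on anything downstream ([IUTchIII] Cor. 3.12 in particular).
-/

namespace Literature.AnabelianGeometry.EtaleTheta

open CategoryTheory

universe w v v' u u'

namespace ThetaFrobenioid

variable {C : Type u} [Category.{v} C] {D : Type u'} [Category.{v'} D] {𝔉 : ThetaFrobenioid.{w} C D}

/-! ## §1. `HC` at `ξ := w` is a tautology of the normalised transport -/

section Transport

variable (Ψ : C ≌ C) (α : Ψ.functor.obj 𝔉.AN ≅ 𝔉.AN) (β : Ψ.functor.obj 𝔉.BN ≅ 𝔉.BN) (e : 𝔉.AN ≅ 𝔉.AN) (w : Aut 𝔉.BN)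
  (θ : Aut (𝔉.base.obj 𝔉.BN) ≃* Aut (𝔉.base.obj 𝔉.BN))

/-- **`HC` at the discrepancy itself.**  For a NORMALISED transport datum `(a, b, e, w)` of `(s^⊓_N, s^⊔_N)` over the base shadow `θ`
(`hT`, `hT′`, `hstrv`, `θ(H_{B_N}) = H_{B_N}`): `Ψ^Aut_β(s^⊓-gp_N(h)·s^⊔-gp_N(h)⁻¹) = (s^⊓-gp_N(θh)·s^⊔-gp_N(θh)⁻¹)·κ_w(θh)` for every
`h ∈ H_{B_N}`, `κ_w(h′) := s^⊔-gp_N(h′)·w·s^⊔-gp_N(h′)⁻¹·w⁻¹` — abc-iut-L2-d4's T3 `psiAut_biKummerDiff` with `D_c := 1`, `D_p := w`; i.e. the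
hypothesis `HC` of `isFixed_discrepancy_of_kummerComparison` (p448195) HOLDS at `ξ := w` with no further input.
[cite: MochizukiEtTh2009, Thm 5.7 proof p.330 (PDF p.104); Prop 4.3 (iii) p.317 (PDF p.91)] -/
theorem kummerComparison_at_discrepancy [Epi 𝔉.sCap] [Epi 𝔉.sCup] (hcap : 𝔉.SgpCapSpec) (hcup : 𝔉.SgpCupSpec)
    (hT : α.inv ≫ Ψ.functor.map 𝔉.sCap ≫ β.hom = e.hom ≫ 𝔉.sCap ≫ (1 : Aut 𝔉.BN).hom)
    (hT' : α.inv ≫ Ψ.functor.map 𝔉.sCup ≫ β.hom = e.hom ≫ 𝔉.sCup ≫ w.hom)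
    (hstrv : ∀ g : Aut (𝔉.base.obj 𝔉.BN),
      α.inv ≫ Ψ.functor.map (𝔉.strv (𝔉.autBaseIsoAB.symm g)).hom ≫ α.hom ≫ e.hom =
        e.hom ≫ (𝔉.strv (𝔉.autBaseIsoAB.symm (θ g))).hom)
    (hYdd : 𝔉.HB.map θ.toMonoidHom = 𝔉.HB) (h : 𝔉.HB) :
    𝔉.psiAut Ψ β (𝔉.sgpCap (h : Aut (𝔉.base.obj 𝔉.BN)) * (𝔉.sgpCup h)⁻¹) =
      (𝔉.sgpCap (θ h) * (𝔉.sgpCup ⟨θ h, (mem_iff_of_map_equiv_eq hYdd _).mpr h.2⟩)⁻¹) *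
        (𝔉.sgpCup ⟨θ h, (mem_iff_of_map_equiv_eq hYdd _).mpr h.2⟩ * w *
          (𝔉.sgpCup ⟨θ h, (mem_iff_of_map_equiv_eq hYdd _).mpr h.2⟩)⁻¹ * w⁻¹) := by
  rw [psiAut_biKummerDiff Ψ α β e 1 w θ hcap hcup hT hT' hstrv hYdd h]
  simp only [inv_one, one_mul, mul_one]

/-- The same read at a representative: for `k ∈ Π^tp_Ÿ̲` and `h ∈ H_{B_N}` with `θ(ρ k) = h`,
`Ψ^Aut_β(s^⊓-gp_N(ρ k)·s^⊔-gp_N(ρ k)⁻¹) = (s^⊓-gp_N(h)·s^⊔-gp_N(h)⁻¹)·κ_w(h)`.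
[cite: MochizukiEtTh2009, Thm 5.7 proof p.330 (PDF p.104); Prop 4.3 (iii) p.317 (PDF p.91)] -/
theorem kummerComparison_at_discrepancy_of_eq [Epi 𝔉.sCap] [Epi 𝔉.sCup] (hcap : 𝔉.SgpCapSpec) (hcup : 𝔉.SgpCupSpec)
    (hT : α.inv ≫ Ψ.functor.map 𝔉.sCap ≫ β.hom = e.hom ≫ 𝔉.sCap ≫ (1 : Aut 𝔉.BN).hom)
    (hT' : α.inv ≫ Ψ.functor.map 𝔉.sCup ≫ β.hom = e.hom ≫ 𝔉.sCup ≫ w.hom)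
    (hstrv : ∀ g : Aut (𝔉.base.obj 𝔉.BN),
      α.inv ≫ Ψ.functor.map (𝔉.strv (𝔉.autBaseIsoAB.symm g)).hom ≫ α.hom ≫ e.hom =
        e.hom ≫ (𝔉.strv (𝔉.autBaseIsoAB.symm (θ g))).hom)
    (hYdd : 𝔉.HB.map θ.toMonoidHom = 𝔉.HB) (k : 𝔉.PiYdd) (h : 𝔉.HB) (hh : θ (𝔉.ρ k) = h) :
    𝔉.psiAut Ψ β (𝔉.sgpCap (𝔉.ρ k) * (𝔉.sgpCup (𝔉.rhoYdd k))⁻¹) =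
      (𝔉.sgpCap (h : Aut (𝔉.base.obj 𝔉.BN)) * (𝔉.sgpCup h)⁻¹) * (𝔉.sgpCup h * w * (𝔉.sgpCup h)⁻¹ * w⁻¹) := by
  have e₀ : (⟨θ (𝔉.rhoYdd k : Aut (𝔉.base.obj 𝔉.BN)), (mem_iff_of_map_equiv_eq hYdd _).mpr (𝔉.rhoYdd k).2⟩ : 𝔉.HB) = h :=
    Subtype.ext hh
  exact (kummerComparison_at_discrepancy Ψ α β e w θ hcap hcup hT hT' hstrv hYdd (𝔉.rhoYdd k)).trans
    (congrArg (fun x : 𝔉.HB => (𝔉.sgpCap (x : Aut (𝔉.base.obj 𝔉.BN)) * (𝔉.sgpCup x)⁻¹) *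
      (𝔉.sgpCup x * w * (𝔉.sgpCup x)⁻¹ * w⁻¹)) e₀)

/-- **`HC` at ANY unit with the same `H_{B_N}`-Kummer cocycle as the discrepancy.**  If `ξ` and `w` have the same Kummer cocycle
`h ↦ s^⊔-gp_N(h)·(−)·s^⊔-gp_N(h)⁻¹·(−)⁻¹` on `H_{B_N}` (hypothesis `htor`), then `HC` holds at `ξ` — §1 rewritten; this is the ONLY way
the unit `ξ` enters `HC`. [cite: MochizukiEtTh2009, Thm 5.7 proof p.330 (PDF p.104); Lem 5.8 p.331 (PDF p.105)] -/
theorem kummerComparison_of_kummerCocycle_eq [Epi 𝔉.sCap] [Epi 𝔉.sCup] (hcap : 𝔉.SgpCapSpec) (hcup : 𝔉.SgpCupSpec)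
    (hT : α.inv ≫ Ψ.functor.map 𝔉.sCap ≫ β.hom = e.hom ≫ 𝔉.sCap ≫ (1 : Aut 𝔉.BN).hom)
    (hT' : α.inv ≫ Ψ.functor.map 𝔉.sCup ≫ β.hom = e.hom ≫ 𝔉.sCup ≫ w.hom)
    (hstrv : ∀ g : Aut (𝔉.base.obj 𝔉.BN),
      α.inv ≫ Ψ.functor.map (𝔉.strv (𝔉.autBaseIsoAB.symm g)).hom ≫ α.hom ≫ e.hom =
        e.hom ≫ (𝔉.strv (𝔉.autBaseIsoAB.symm (θ g))).hom)
    (hYdd : 𝔉.HB.map θ.toMonoidHom = 𝔉.HB) (ξ : Aut 𝔉.BN)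
    (htor : ∀ h : 𝔉.HB, 𝔉.sgpCup h * ξ * (𝔉.sgpCup h)⁻¹ * ξ⁻¹ = 𝔉.sgpCup h * w * (𝔉.sgpCup h)⁻¹ * w⁻¹) (h : 𝔉.HB) :
    𝔉.psiAut Ψ β (𝔉.sgpCap (h : Aut (𝔉.base.obj 𝔉.BN)) * (𝔉.sgpCup h)⁻¹) =
      (𝔉.sgpCap (θ h) * (𝔉.sgpCup ⟨θ h, (mem_iff_of_map_equiv_eq hYdd _).mpr h.2⟩)⁻¹) *
        (𝔉.sgpCup ⟨θ h, (mem_iff_of_map_equiv_eq hYdd _).mpr h.2⟩ * ξ *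
          (𝔉.sgpCup ⟨θ h, (mem_iff_of_map_equiv_eq hYdd _).mpr h.2⟩)⁻¹ * ξ⁻¹) := by
  rw [htor, kummerComparison_at_discrepancy Ψ α β e w θ hcap hcup hT hT' hstrv hYdd h]

end Transport

/-! ## §2. The clause `hC5` HOLDS at `κ := κ_w` -/

section Etale

variable [Epi 𝔉.sCup] (H : 𝔉.Facts)
  (T : ThetaEnvData.{v} 𝔉.N) (ι : 𝔉.PiX ≃* T.PiX) (m : 𝔉.muTorsion 𝔉.BN 𝔉.N ≃* T.mu) (hι : 𝔉.IdentifiesPiYdd T ι)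
  {η : T.PiYdd → T.mu} (hpin : 𝔉.ThetaSectionCompat H T ι m hι η)
  (Ψ : C ≌ C) (α : Ψ.functor.obj 𝔉.AN ≅ 𝔉.AN) (β : Ψ.functor.obj 𝔉.BN ≅ 𝔉.BN) (e : 𝔉.AN ≅ 𝔉.AN) (w : Aut 𝔉.BN)
  (θ : Aut (𝔉.base.obj 𝔉.BN) ≃* Aut (𝔉.base.obj 𝔉.BN)) (hYdd : 𝔉.HB.map θ.toMonoidHom = 𝔉.HB)
  (hT : α.inv ≫ Ψ.functor.map 𝔉.sCap ≫ β.hom = e.hom ≫ 𝔉.sCap ≫ (1 : Aut 𝔉.BN).hom)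
  (hT' : α.inv ≫ Ψ.functor.map 𝔉.sCup ≫ β.hom = e.hom ≫ 𝔉.sCup ≫ w.hom)
  (hstrv : ∀ g : Aut (𝔉.base.obj 𝔉.BN),
    α.inv ≫ Ψ.functor.map (𝔉.strv (𝔉.autBaseIsoAB.symm g)).hom ≫ α.hom ≫ e.hom =
      e.hom ≫ (𝔉.strv (𝔉.autBaseIsoAB.symm (θ g))).hom)
  (γ : T.PiX → T.PiX) (hγ : ∀ x : T.PiX, x ∈ T.PiYdd → γ x ∈ T.PiYdd) (γΔ : T.mu → T.mu)
  (hshadow : ∀ k : 𝔉.PiYdd, θ (𝔉.ρ k) = 𝔉.ρ (ι.symm (γ (ι k))))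
  (hK4 : ∀ x : T.mu, 𝔉.psiAut Ψ β ((m.symm x : 𝔉.muTorsion 𝔉.BN 𝔉.N) : Aut 𝔉.BN) =
    ((m.symm (γΔ x) : 𝔉.muTorsion 𝔉.BN 𝔉.N) : Aut 𝔉.BN))

include hpin hYdd hT hT' hstrv hγ hshadow hK4

/-- **`hC5` at `κ_w` (abc-iut-L2-d3's HC-TAUTOLOGY, J-L2d3-1 (1)).**  Data: the §5 facts `H`, the dictionary `(T, ι, m, η)` with the pin
(Prop. 5.2 (iii), `ThetaSectionCompat`), a NORMALISED transport datum `(a, b, e, w)` over the base shadow `θ`, the étale action `(γ, γ_Δ)` with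
(shadow) and (K4m) (Thm. 5.6) — all VERBATIM the binders of p458762 — and a function `κ : Π^tp_Ÿ → μ_N` realising the Kummer cocycle of
the DISCREPANCY `w` (`hκw` = p458762's `hκ` at `ξ := w`).  THEN p458762's binder `hC5 : γ_Δ(η k) = η(γ k)·κ(γ k)` HOLDS for every
`k ∈ Π^tp_Ÿ`: both sides, pushed through `m⁻¹`, are `Ψ^Aut_β` of the bi-Kummer difference cocycle at `ρ(ι⁻¹k)` — the left by (K4m) and the
pin, the right by the pin at `ι⁻¹γk`, (shadow) and §1.  So Cor. 2.8 (i)'s role in the (C)-chain is NOT the identity `hC5` but the nature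
of `κ_w` (see §4). [cite: MochizukiEtTh2009, Thm 5.7 proof p.330 (PDF p.104); Thm 5.6 p.328 (PDF p.102); Prop 5.2 (iii) p.324 (PDF p.98)] -/
theorem hC5_of_kummerCocycle_discrepancy {κ : T.PiYdd → T.mu}
    (hκw : ∀ k : 𝔉.PiYdd, ((m.symm (κ ⟨ι k, (hι k).mp k.2⟩) : 𝔉.muTorsion 𝔉.BN 𝔉.N) : Aut 𝔉.BN) =
      𝔉.sgpCup (𝔉.rhoYdd k) * w * (𝔉.sgpCup (𝔉.rhoYdd k))⁻¹ * w⁻¹) (k : T.PiYdd) :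
    γΔ (η k) = η ⟨γ k, hγ k k.2⟩ * κ ⟨γ k, hγ k k.2⟩ := by
  haveI : Epi 𝔉.sCap := H.epi_sCap
  -- representatives `k₀ := ι⁻¹ k`, `k₁ := ι⁻¹ (γ k)` in `Π^tp_Ÿ̲`
  have hk₀ : ι.symm (k : T.PiX) ∈ 𝔉.PiYdd := (hι _).mpr (by rw [MulEquiv.apply_symm_apply]; exact k.2)
  have hk₁ : ι.symm (γ k) ∈ 𝔉.PiYdd := (hι _).mpr (by rw [MulEquiv.apply_symm_apply]; exact hγ k k.2)
  have ek₀ : (⟨ι (ι.symm (k : T.PiX)), (hι _).mp hk₀⟩ : T.PiYdd) = k := Subtype.ext (MulEquiv.apply_symm_apply ι _)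
  have ek₁ : (⟨ι (ι.symm (γ k)), (hι _).mp hk₁⟩ : T.PiYdd) = ⟨γ k, hγ k k.2⟩ := Subtype.ext (MulEquiv.apply_symm_apply ι _)
  -- (shadow): `θ(ρ k₀) = ρ k₁`
  have hθ : θ (𝔉.ρ (ι.symm (k : T.PiX))) = (𝔉.rhoYdd ⟨ι.symm (γ k), hk₁⟩ : Aut (𝔉.base.obj 𝔉.BN)) := by
    have hs : θ (𝔉.ρ (ι.symm (k : T.PiX))) = 𝔉.ρ (ι.symm (γ (ι (ι.symm (k : T.PiX))))) :=
      hshadow ⟨ι.symm (k : T.PiX), hk₀⟩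
    rw [MulEquiv.apply_symm_apply] at hs
    exact hs
  -- the pins at `k₀` and `k₁` (Prop. 5.2 (iii)), read at `k` and `γ k`
  have pin₀ : 𝔉.sgpCap (𝔉.ρ (ι.symm (k : T.PiX))) * (𝔉.sgpCup (𝔉.rhoYdd ⟨ι.symm (k : T.PiX), hk₀⟩))⁻¹ =
      ((m.symm (η k) : 𝔉.muTorsion 𝔉.BN 𝔉.N) : Aut 𝔉.BN) :=
    (𝔉.sgpCap_mul_sgpCup_inv_eq_of_thetaSectionCompat H T ι m hι hpin ⟨ι.symm (k : T.PiX), hk₀⟩).trans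
      (congrArg (fun t : T.PiYdd => ((m.symm (η t) : 𝔉.muTorsion 𝔉.BN 𝔉.N) : Aut 𝔉.BN)) ek₀)
  have pin₁ : 𝔉.sgpCap (𝔉.rhoYdd ⟨ι.symm (γ k), hk₁⟩ : Aut (𝔉.base.obj 𝔉.BN)) *
        (𝔉.sgpCup (𝔉.rhoYdd ⟨ι.symm (γ k), hk₁⟩))⁻¹ =
      ((m.symm (η ⟨γ k, hγ k k.2⟩) : 𝔉.muTorsion 𝔉.BN 𝔉.N) : Aut 𝔉.BN) :=
    (𝔉.sgpCap_mul_sgpCup_inv_eq_of_thetaSectionCompat H T ι m hι hpin ⟨ι.symm (γ k), hk₁⟩).trans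
      (congrArg (fun t : T.PiYdd => ((m.symm (η t) : 𝔉.muTorsion 𝔉.BN 𝔉.N) : Aut 𝔉.BN)) ek₁)
  -- `hκw` at `k₁`, read at `γ k`
  have hκ₁ : ((m.symm (κ ⟨γ k, hγ k k.2⟩) : 𝔉.muTorsion 𝔉.BN 𝔉.N) : Aut 𝔉.BN) =
      𝔉.sgpCup (𝔉.rhoYdd ⟨ι.symm (γ k), hk₁⟩) * w * (𝔉.sgpCup (𝔉.rhoYdd ⟨ι.symm (γ k), hk₁⟩))⁻¹ * w⁻¹ :=
    (congrArg (fun t : T.PiYdd => ((m.symm (κ t) : 𝔉.muTorsion 𝔉.BN 𝔉.N) : Aut 𝔉.BN)) ek₁).symm.trans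
      (hκw ⟨ι.symm (γ k), hk₁⟩)
  -- push through `m⁻¹` (injective) into `Aut_C(B_N)` and compare with §1 at `(k₀, ρ k₁)`
  apply m.symm.injective
  apply Subtype.ext
  rw [map_mul, Subgroup.coe_mul, ← hK4 (η k), ← pin₀, hκ₁, ← pin₁]
  exact kummerComparison_at_discrepancy_of_eq Ψ α β e w θ H.sgpCapSpec H.sgpCupSpec hT hT' hstrv hYdd
    ⟨ι.symm (k : T.PiX), hk₀⟩ (𝔉.rhoYdd ⟨ι.symm (γ k), hk₁⟩) hθ

/-! ## §3. The function `κ_w` exists (`μ_N`-valuedness of the discrepancy cocycle) -/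

/-- **Under (pin) + (K4m) + (shadow) the Kummer cocycle of the discrepancy is `μ_N(B_N)`-valued on `H_{B_N}`**: at `h = θ(ρ k₀)` it equals
`m⁻¹(η(ι k₁))⁻¹ · m⁻¹(γ_Δ(η(ι k₀)))` (`k₁ := ι⁻¹γιk₀`) by §1, and every `h ∈ H_{B_N} = θ(ρ(Π^tp_Ÿ̲))` is of this form.
[cite: MochizukiEtTh2009, Thm 5.7 proof p.330 (PDF p.104); Prop 5.2 (iii) p.324 (PDF p.98)] -/
theorem kummerCocycle_discrepancy_mem_muTorsion (h : 𝔉.HB) :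
    𝔉.sgpCup h * w * (𝔉.sgpCup h)⁻¹ * w⁻¹ ∈ 𝔉.muTorsion 𝔉.BN 𝔉.N := by
  haveI : Epi 𝔉.sCap := H.epi_sCap
  -- `θ⁻¹ h ∈ H_{B_N} = ρ(Π^tp_Ÿ̲)`: pick `k₀` with `ρ k₀ = θ⁻¹ h`
  have hθh : θ.symm (h : Aut (𝔉.base.obj 𝔉.BN)) ∈ 𝔉.HB :=
    (mem_iff_of_map_equiv_eq (map_symm_eq_of_map_equiv_eq hYdd) _).mpr h.2
  obtain ⟨k₀, hk₀, hρk₀⟩ := Subgroup.mem_map.mp hθh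
  have hθρ : θ (𝔉.ρ k₀) = h := by rw [hρk₀, MulEquiv.apply_symm_apply]
  -- the representative `k₁ := ι⁻¹ γ ι k₀` of `h = θ(ρ k₀)`
  have hk₁ : ι.symm (γ (ι k₀)) ∈ 𝔉.PiYdd :=
    (hι _).mpr (by rw [MulEquiv.apply_symm_apply]; exact hγ _ ((hι k₀).mp hk₀))
  have hs : θ (𝔉.ρ k₀) = 𝔉.ρ (ι.symm (γ (ι k₀))) := hshadow ⟨k₀, hk₀⟩
  have eHB₁ : 𝔉.rhoYdd ⟨ι.symm (γ (ι k₀)), hk₁⟩ = h := Subtype.ext (hs.symm.trans hθρ)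
  -- §1 at `(k₀, h)`, with the pins and (K4m) substituted
  have key := kummerComparison_at_discrepancy_of_eq Ψ α β e w θ H.sgpCapSpec H.sgpCupSpec hT hT' hstrv hYdd ⟨k₀, hk₀⟩ h hθρ
  have pin₀ : 𝔉.sgpCap (𝔉.ρ ((⟨k₀, hk₀⟩ : 𝔉.PiYdd) : 𝔉.PiX)) * (𝔉.sgpCup (𝔉.rhoYdd ⟨k₀, hk₀⟩))⁻¹ =
      ((m.symm (η ⟨ι k₀, (hι k₀).mp hk₀⟩) : 𝔉.muTorsion 𝔉.BN 𝔉.N) : Aut 𝔉.BN) :=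
    𝔉.sgpCap_mul_sgpCup_inv_eq_of_thetaSectionCompat H T ι m hι hpin ⟨k₀, hk₀⟩
  have pin₁ : 𝔉.sgpCap (h : Aut (𝔉.base.obj 𝔉.BN)) * (𝔉.sgpCup h)⁻¹ =
      ((m.symm (η ⟨ι (ι.symm (γ (ι k₀))), (hι _).mp hk₁⟩) : 𝔉.muTorsion 𝔉.BN 𝔉.N) : Aut 𝔉.BN) := by
    rw [← eHB₁]
    exact 𝔉.sgpCap_mul_sgpCup_inv_eq_of_thetaSectionCompat H T ι m hι hpin ⟨ι.symm (γ (ι k₀)), hk₁⟩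
  rw [pin₀, hK4, pin₁] at key
  rw [eq_inv_mul_of_mul_eq key.symm, ← Subgroup.coe_inv, ← Subgroup.coe_mul]
  exact SetLike.coe_mem _

/-- **`∃ κ, hκ@(ξ := w) ∧ hC5`** (abc-iut-L2-d3's 'exists_hC5_of_kummerComparison'): the function `κ_w : Π^tp_Ÿ → μ_N`,
`κ_w(k′) := m(s^⊔-gp_N(ρ(ι⁻¹k′))·w·s^⊔-gp_N(ρ(ι⁻¹k′))⁻¹·w⁻¹)` (well defined by `kummerCocycle_discrepancy_mem_muTorsion`), realises
p458762's binder `hκ` AT THE DISCREPANCY `ξ := w` and satisfies its binder `hC5` (§2) — from (pin) + (K4m) + (shadow) + the normalised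
transport only. [cite: MochizukiEtTh2009, Thm 5.7 proof p.330 (PDF p.104); Thm 5.6 p.328 (PDF p.102); Prop 5.2 (iii) p.324 (PDF p.98)] -/
theorem exists_kappa_discrepancy_hC5 :
    ∃ κ : T.PiYdd → T.mu,
      (∀ k : 𝔉.PiYdd, ((m.symm (κ ⟨ι k, (hι k).mp k.2⟩) : 𝔉.muTorsion 𝔉.BN 𝔉.N) : Aut 𝔉.BN) =
        𝔉.sgpCup (𝔉.rhoYdd k) * w * (𝔉.sgpCup (𝔉.rhoYdd k))⁻¹ * w⁻¹) ∧
      ∀ k : T.PiYdd, γΔ (η k) = η ⟨γ k, hγ k k.2⟩ * κ ⟨γ k, hγ k k.2⟩ := by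
  -- `κ_w`, through the representative `ι⁻¹ k′ ∈ Π^tp_Ÿ̲` of `k′ ∈ Π^tp_Ÿ`
  have hmem : ∀ k' : T.PiYdd, ι.symm (k' : T.PiX) ∈ 𝔉.PiYdd := fun k' =>
    (hι _).mpr (by rw [MulEquiv.apply_symm_apply]; exact k'.2)
  let κ : T.PiYdd → T.mu := fun k' =>
    m ⟨𝔉.sgpCup (𝔉.rhoYdd ⟨ι.symm (k' : T.PiX), hmem k'⟩) * w * (𝔉.sgpCup (𝔉.rhoYdd ⟨ι.symm (k' : T.PiX), hmem k'⟩))⁻¹ * w⁻¹,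
      kummerCocycle_discrepancy_mem_muTorsion H T ι m hι hpin Ψ α β e w θ hYdd hT hT' hstrv γ hγ γΔ hshadow hK4 _⟩
  have hκw : ∀ k : 𝔉.PiYdd, ((m.symm (κ ⟨ι k, (hι k).mp k.2⟩) : 𝔉.muTorsion 𝔉.BN 𝔉.N) : Aut 𝔉.BN) =
      𝔉.sgpCup (𝔉.rhoYdd k) * w * (𝔉.sgpCup (𝔉.rhoYdd k))⁻¹ * w⁻¹ := by
    intro k
    have ek : (⟨ι.symm ((⟨ι k, (hι k).mp k.2⟩ : T.PiYdd) : T.PiX), hmem ⟨ι k, (hι k).mp k.2⟩⟩ : 𝔉.PiYdd) = k :=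
      Subtype.ext (MulEquiv.symm_apply_apply ι _)
    have h1 : ((m.symm (κ ⟨ι k, (hι k).mp k.2⟩) : 𝔉.muTorsion 𝔉.BN 𝔉.N) : Aut 𝔉.BN) =
        𝔉.sgpCup (𝔉.rhoYdd ⟨ι.symm ((⟨ι k, (hι k).mp k.2⟩ : T.PiYdd) : T.PiX), hmem ⟨ι k, (hι k).mp k.2⟩⟩) * w *
          (𝔉.sgpCup (𝔉.rhoYdd ⟨ι.symm ((⟨ι k, (hι k).mp k.2⟩ : T.PiYdd) : T.PiX), hmem ⟨ι k, (hι k).mp k.2⟩⟩))⁻¹ * w⁻¹ :=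
      congrArg Subtype.val (MulEquiv.symm_apply_apply m _)
    rw [h1]
    exact congrArg (fun t : 𝔉.PiYdd => 𝔉.sgpCup (𝔉.rhoYdd t) * w * (𝔉.sgpCup (𝔉.rhoYdd t))⁻¹ * w⁻¹) ek
  exact ⟨κ, hκw, hC5_of_kummerCocycle_discrepancy H T ι m hι hpin Ψ α β e w θ hYdd hT hT' hstrv γ hγ γΔ hshadow hK4 hκw⟩

end Etale

/-! ## §4. Consequently the per-level clause of `hrigid` needs only (tor) about the discrepancy -/

/-- **The per-level clause of `hrigid` from the normalised transport + (tor) ALONE.**  Data: the §5 facts `H`, the factorisation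
`hfac` (GAP G-L2d4-1), a NORMALISED transport datum `(a, b, e, w)` of `(s^⊓_N, s^⊔_N)` over the base shadow `θ` with `w ∈ O^×(B_N)` —
VERBATIM p458762's — and (tor): a torsion element `u ∈ μ_N(B_N)` and a unit `ζroot ∈ O^×(B_N)` with `ζroot^N = z` in `O^×(B_N^birat)`
such that `ξ := u·ζroot` has the SAME `H_{B_N}`-Kummer cocycle as the discrepancy `w` (`htor`).  Conclusion — VERBATIM the level-`N`
clause of `hrigid` (= p458762's conclusion): `∃ ξ ∈ O^×(B_N), ξ^N = z ∧ ∀ y ∈ Π_Y, s^⊓-gp_N(y)·(w·ξ⁻¹)·s^⊓-gp_N(y)⁻¹ = w·ξ⁻¹`.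
NO pin, NO Thm. 5.6, NO Cor. 2.8 (i) clause is consumed: by §1 the comparison `HC` at `ξ` IS `htor`, and p448195 does the rest.  So the
étale content R-C5 owes the (C)-chain is exactly (tor) (abc-iut-L2-d3's (II′) + the identification of `κ_w`'s class, (SEP)/(T3)).
[cite: MochizukiEtTh2009, Thm 5.7 proof p.330 (PDF p.104); Lem 5.8 p.331 (PDF p.105)] -/
theorem exists_torsionRoot_isFixed_of_kummerCocycle_eq [Epi 𝔉.sCup] (H : 𝔉.Facts)
    (hfac : ∀ y ∈ 𝔉.imPiY, ∃ x ∈ 𝔉.HB, ∀ u ∈ 𝔉.units 𝔉.BN,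
      𝔉.sgpCap y * u * (𝔉.sgpCap y)⁻¹ = 𝔉.sgpCap x * u * (𝔉.sgpCap x)⁻¹)
    (Ψ : C ≌ C) (α : Ψ.functor.obj 𝔉.AN ≅ 𝔉.AN) (β : Ψ.functor.obj 𝔉.BN ≅ 𝔉.BN) (e : 𝔉.AN ≅ 𝔉.AN) (w : Aut 𝔉.BN)
    (θ : Aut (𝔉.base.obj 𝔉.BN) ≃* Aut (𝔉.base.obj 𝔉.BN)) (hYdd : 𝔉.HB.map θ.toMonoidHom = 𝔉.HB)
    (hT : α.inv ≫ Ψ.functor.map 𝔉.sCap ≫ β.hom = e.hom ≫ 𝔉.sCap ≫ (1 : Aut 𝔉.BN).hom)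
    (hT' : α.inv ≫ Ψ.functor.map 𝔉.sCup ≫ β.hom = e.hom ≫ 𝔉.sCup ≫ w.hom)
    (hstrv : ∀ g : Aut (𝔉.base.obj 𝔉.BN),
      α.inv ≫ Ψ.functor.map (𝔉.strv (𝔉.autBaseIsoAB.symm g)).hom ≫ α.hom ≫ e.hom =
        e.hom ≫ (𝔉.strv (𝔉.autBaseIsoAB.symm (θ g))).hom)
    (hw : w ∈ 𝔉.units 𝔉.BN)
    (u : 𝔉.muTorsion 𝔉.BN 𝔉.N) {ζroot : Aut 𝔉.BN} (hζu : ζroot ∈ 𝔉.units 𝔉.BN) {z : 𝔉.biratUnits 𝔉.BN}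
    (hζ : 𝔉.unitsToBirat 𝔉.BN ⟨ζroot, hζu⟩ ^ (𝔉.N : ℕ) = z)
    (htor : ∀ h : 𝔉.HB, 𝔉.sgpCup h * ((u : Aut 𝔉.BN) * ζroot) * (𝔉.sgpCup h)⁻¹ * ((u : Aut 𝔉.BN) * ζroot)⁻¹ =
      𝔉.sgpCup h * w * (𝔉.sgpCup h)⁻¹ * w⁻¹) :
    ∃ ξ : 𝔉.units 𝔉.BN, 𝔉.unitsToBirat 𝔉.BN ξ ^ (𝔉.N : ℕ) = z ∧
      ∀ y ∈ 𝔉.imPiY, 𝔉.sgpCap y * (w * (ξ : Aut 𝔉.BN)⁻¹) * (𝔉.sgpCap y)⁻¹ = w * (ξ : Aut 𝔉.BN)⁻¹ := by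
  haveI : Epi 𝔉.sCap := H.epi_sCap
  have hξ : (u : Aut 𝔉.BN) * ζroot ∈ 𝔉.units 𝔉.BN := mul_mem (𝔉.muTorsion_le_units _ _ u.2) hζu
  have HC := kummerComparison_of_kummerCocycle_eq Ψ α β e w θ H.sgpCapSpec H.sgpCupSpec hT hT' hstrv hYdd
    ((u : Aut 𝔉.BN) * ζroot) htor
  refine ⟨⟨_, hξ⟩, ?_, isFixed_discrepancy_of_kummerComparison Ψ α β e w _ θ H.sgpCapSpec H.sgpCupSpec H.biKummerDifferenceMem
    hfac hT hT' hstrv hYdd hw hξ HC⟩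
  rw [← hζ]
  exact unitsToBirat_muTorsion_mul_pow u hζu

end ThetaFrobenioid

end Literature.AnabelianGeometry.EtaleTheta
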